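import Summits.BirchSwinnertonDyer.BirchSwinnertonDyer.Theorems.UniversalToricDescentTowerNoPTorsion
import Summits.BirchSwinnertonDyer.Rank1Residual.O6.X4CongruenceAnchor
import HarnessLib

/-!
# The local `H⁰`-input of the residual comparison is the SAME for a mod-`p` congruent twin —
# route `UniversalToricDescent`, child 20399 `InvariantsTransportModThree` (crux #2, 20186)

Lead prover bsd-wall-utd-p1 g5 (`--supports stmt-BirchSwinnertonDyer-20399`, mechanism helper; sequel
of `Theorems/UniversalToricDescentTowerNoPTorsion.lean`, p558293; memo
HOME/bsd-wall-utd-p1/PRICING-20399-ALG-HALF-utdp1g5.md §2 (L)). For `W, W′/ℚ` with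
`W′[p] ≅ W[p]` as `Γ_ℚ`-modules (the route's binder `O6.ModPCongruent W′ W p`) and ANY `ℚ`-field `E`
of characteristic `0` (e.g. `E = K_𝔭′`): `W(E)[p] = 0 ↔ W′(E)[p] = 0`
(`baseChange_noPTorsion_iff_of_modPCongruent`). Hence, by the previous file, the hypothesis
«`E(K_𝔭′)[3] = 0`» that makes the residual Selmer comparison EXACT at the strict places `w ∣ 𝔭′`
holds for the wild curve `E` iff it holds for its semistable twin `E′` — one census-decidable
condition serves both sides of the Greenberg–Vatsal transport. Proof: an `E`-rational point of order
`p` of `W′` is a `Γ_E`-fixed element of `W′(Ē)[p]`; all of `W′(Ē)[p]` comes from `W′(ℚ̄)[p]`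
(injective `pointsMapOfEmb ι` between two sets of `p²` points), where `Γ_E` acts through
`resGalOfEmb ι : Γ_E → Γ_ℚ`; transport the fixed vector along the equivariant `W′[p] ≃ W[p]`, push it
to `W(Ē)` and descend (`localPoints_eq_zero_of_forall_smul_eq_of_base`). HONEST STATUS: elementary
Galois descent; nothing of 20399/20395 is proved; no definition, no named fact, no `sorry`.
BSD is not proved by any of this.

References: [Serre1972] §4 (the Galois module `E[p]`); [SilvermanAEC2009] III.§7, VIII.§1;
[GreenbergVatsal2000] §2.
-/

noncomputable section

open scoped Classical AddSubgroup

open WeierstrassCurve Literature.NumberTheory.EllipticCurves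
  Summit.BirchSwinnertonDyer.Rank1Residual.O6

set_option linter.dupNamespace false
set_option autoImplicit false

namespace Summit.BirchSwinnertonDyer.BirchSwinnertonDyer.Theorems.UniversalToricDescentTowerTorsion

section Twin

variable (p : ℕ) [Fact p.Prime] (W W' : WeierstrassCurve ℚ) [W.IsElliptic] [W'.IsElliptic]
  (E : Type) [Field E] [CharZero E]

/-- **Every `p`-torsion point of `W(Ē)` comes from `W(ℚ̄)[p]`**: `pointsMapOfEmb ι` is injective and
both `W(ℚ̄)[p]` and `W(Ē)[p]` have `p²` elements. [cite: SilvermanAEC2009, Cor. III.6.4(b)] -/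
theorem exists_geomTorsion_pointsMapOfEmb_eq (ι : AlgebraicClosure ℚ →ₐ[ℚ] AlgebraicClosure E)
    {P : localPoints W E} (hP : p • P = 0) :
    ∃ R : W.geomTorsion (p : ℤ), pointsMapOfEmb W ι (R : W.geomPoints) = P := by
  have hp : p.Prime := Fact.out
  -- the restriction of `pointsMapOfEmb ι` to `p`-torsion
  let f : W.geomTorsion (p : ℤ) → (localPoints W E)[(p : ℕ)] := fun R ↦
    ⟨pointsMapOfEmb W ι (R : W.geomPoints), by
      rw [AddSubgroup.torsionBy.nsmul_iff, ← map_nsmul]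
      have hR : p • (R : W.geomPoints) = 0 := by
        rw [← AddSubmonoidClass.coe_nsmul, AddSubgroup.torsionBy.nsmul, ZeroMemClass.coe_zero]
      rw [hR, map_zero]⟩
  have hf : Function.Injective f := by
    intro R₁ R₂ h
    have h' := congrArg (fun z : (localPoints W E)[(p : ℕ)] ↦ (z : localPoints W E)) h
    exact Subtype.ext (pointsMapOfEmb_injective W ι h')
  -- cardinalities: `p²` on both sides
  have hpQ : ((p : ℕ) : AlgebraicClosure ℚ) ≠ 0 := by exact_mod_cast hp.ne_zero
  have hpE : ((p : ℕ) : AlgebraicClosure E) ≠ 0 := by exact_mod_cast hp.ne_zero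
  have hc1 : Nat.card (W.geomTorsion (p : ℤ)) = p ^ 2 :=
    WeierstrassCurve.card_torsionPoints_eq_sq_holds W (AlgebraicClosure ℚ) (n := p) hpQ
  have hc2 : Nat.card ((localPoints W E)[(p : ℕ)]) = p ^ 2 :=
    WeierstrassCurve.card_torsionPoints_eq_sq_holds W (AlgebraicClosure E) (n := p) hpE
  haveI : Finite ((localPoints W E)[(p : ℕ)]) :=
    Nat.finite_of_card_ne_zero (by rw [hc2]; exact pow_ne_zero 2 hp.ne_zero)
  have hbij : Function.Bijective f := hf.bijective_of_nat_card_le (by rw [hc1, hc2])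
  obtain ⟨R, hR⟩ := hbij.2 ⟨P, AddSubgroup.torsionBy.nsmul_iff.mpr hP⟩
  exact ⟨R, by simpa [f] using congrArg (fun z : (localPoints W E)[(p : ℕ)] ↦ (z : localPoints W E)) hR⟩

omit [W.IsElliptic] in
/-- **Mod-`p` congruent curves have the same `E`-rational `p`-torsion condition** (one direction):
if `W′[p] ≅ W[p]` `Γ_ℚ`-equivariantly (`ModPCongruent W′ W p`) and `W(E)` has no point of order `p`,
then neither has `W′(E)`, for any `ℚ`-field `E` of characteristic `0` (the proof uses the tree's
embedding `closureEmb E : ℚ̄ → Ē`). [cite: Serre1972, §4] [cite: SilvermanAEC2009, VIII.§1 (Galois descent)] -/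
theorem baseChange_noPTorsion_of_modPCongruent (hcong : ModPCongruent W' W p)
    (h0 : ∀ Q : (W.baseChange E).toAffine.Point, p • Q = 0 → Q = 0) :
    ∀ Q' : (W'.baseChange E).toAffine.Point, p • Q' = 0 → Q' = 0 := by
  obtain ⟨e, he⟩ := hcong
  intro Q' hQ'
  let ι : AlgebraicClosure ℚ →ₐ[ℚ] AlgebraicClosure E := closureEmb (K := ℚ) E
  -- `P′ ∈ W′(Ē)`: the image of `Q′`, `Γ_E`-fixed and killed by `p`
  set P' : localPoints W' E :=
    (localPointsEquivBaseChange W' E).symm (WeierstrassCurve.toGeomPoints (W'.baseChange E) Q')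
    with hP'def
  have hP'fix : ∀ σ : Field.absoluteGaloisGroup E, σ • P' = P' := fun σ ↦ by
    apply (localPointsEquivBaseChange W' E).injective
    rw [localPointsEquivBaseChange_smul, hP'def, AddEquiv.apply_symm_apply,
      WeierstrassCurve.smul_toGeomPoints]
  have hP'p : p • P' = 0 := by
    rw [hP'def, ← map_nsmul, ← map_nsmul, hQ', map_zero, map_zero]
  -- `P′` comes from `R′ ∈ W′(ℚ̄)[p]`, fixed by the image of `Γ_E` in `Γ_ℚ`
  obtain ⟨R', hR'⟩ := exists_geomTorsion_pointsMapOfEmb_eq p W' E ι hP'p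
  have hR'fix : ∀ σ : Field.absoluteGaloisGroup E, resGalOfEmb ι σ • R' = R' := fun σ ↦ by
    apply Subtype.ext
    apply pointsMapOfEmb_injective W' ι
    rw [AddSubgroup.torsionBy.coe_smul, pointsMapOfEmb_smul, hR', hP'fix σ]
  -- transport along `e : W′[p] ≃ W[p]` and push to `W(Ē)`
  set R : W.geomTorsion (p : ℤ) := e R' with hRdef
  have hRfix : ∀ σ : Field.absoluteGaloisGroup E, resGalOfEmb ι σ • R = R := fun σ ↦ by
    rw [hRdef, ← he, hR'fix σ]
  set P : localPoints W E := pointsMapOfEmb W ι (R : W.geomPoints) with hPdef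
  have hPfix : ∀ σ : Field.absoluteGaloisGroup E, σ • P = P := fun σ ↦ by
    rw [hPdef, ← pointsMapOfEmb_smul, ← AddSubgroup.torsionBy.coe_smul, hRfix σ]
  have hPp : p • P = 0 := by
    have hR : p • (R : W.geomPoints) = 0 := by
      rw [← AddSubmonoidClass.coe_nsmul, AddSubgroup.torsionBy.nsmul, ZeroMemClass.coe_zero]
    rw [hPdef, ← map_nsmul, hR, map_zero]
  -- descent on `W`: `P = 0`, hence `R = 0`, `R′ = 0`, `P′ = 0`, `Q′ = 0`
  have hP0 : P = 0 := localPoints_eq_zero_of_forall_smul_eq_of_base W h0 hPfix hPp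
  have hR0 : R = 0 := by
    apply Subtype.ext
    apply pointsMapOfEmb_injective W ι
    rw [← hPdef, hP0, ZeroMemClass.coe_zero, map_zero]
  have hR'0 : R' = 0 := e.injective (by rw [← hRdef, hR0, map_zero])
  have hP'0 : P' = 0 := by rw [← hR', hR'0, ZeroMemClass.coe_zero, map_zero]
  have hG0 : WeierstrassCurve.toGeomPoints (W'.baseChange E) Q' = 0 := by
    have := congrArg (localPointsEquivBaseChange W' E) hP'0
    rwa [hP'def, AddEquiv.apply_symm_apply, map_zero] at this
  exact WeierstrassCurve.toGeomPoints_injective (W'.baseChange E) (by rw [hG0, map_zero])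

omit [Fact p.Prime] [W.IsElliptic] [W'.IsElliptic] in
/-- `ModPCongruent` is symmetric (the inverse of an equivariant isomorphism is equivariant).
[cite: Serre1972, §4] -/
theorem modPCongruent_symm (hcong : ModPCongruent W' W p) : ModPCongruent W W' p := by
  obtain ⟨e, he⟩ := hcong
  refine ⟨e.symm, fun σ P ↦ e.injective ?_⟩
  rw [he, AddEquiv.apply_symm_apply, AddEquiv.apply_symm_apply]

/-- **`W(E)[p] = 0 ↔ W′(E)[p] = 0` for mod-`p` congruent `W, W′/ℚ`** (`ModPCongruent W′ W p`) and any
`ℚ`-field `E` of characteristic `0`. With `Theorems/UniversalToricDescentTowerNoPTorsion` §1: the local `H⁰`-input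
`E(K_∞·K_𝔭′)[p] = 0` of the residual Selmer comparison at the strict places holds for the wild curve
iff it holds for its semistable twin iff `E(K_𝔭′)[p] = 0` — ONE condition on the base, decided by the
Galois module `E[p]|_{Γ_{K_𝔭′}}` (memo PRICING-20399-ALG-HALF §2 (L)).
[cite: Serre1972, §4] [cite: GreenbergVatsal2000, §2 (the residual comparison)] -/
theorem baseChange_noPTorsion_iff_of_modPCongruent (hcong : ModPCongruent W' W p) :
    (∀ Q : (W.baseChange E).toAffine.Point, p • Q = 0 → Q = 0) ↔
      ∀ Q' : (W'.baseChange E).toAffine.Point, p • Q' = 0 → Q' = 0 :=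
  ⟨baseChange_noPTorsion_of_modPCongruent p W W' E hcong,
    baseChange_noPTorsion_of_modPCongruent p W' W E (modPCongruent_symm p W W' hcong)⟩

/-- **The `p = 3` reading on the binders of 20186/20399** (`O6.ModPCongruent W′ W 3`): for any
`ℚ`-field `E` of characteristic `0` (e.g. `E = K_𝔭′ ≅ ℚ₃`), `W(E)[3] = 0 ↔ W′(E)[3] = 0`; combine with
`localTowerPoints_noThreeTorsion_iff_base` for the anticyclotomic tower. [cite: Serre1972, §4] -/
theorem baseChange_noThreeTorsion_iff_of_modPCongruent (hcong : ModPCongruent W' W 3) :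
    (∀ Q : (W.baseChange E).toAffine.Point, 3 • Q = 0 → Q = 0) ↔
      ∀ Q' : (W'.baseChange E).toAffine.Point, 3 • Q' = 0 → Q' = 0 :=
  haveI : Fact (Nat.Prime 3) := ⟨Nat.prime_three⟩
  baseChange_noPTorsion_iff_of_modPCongruent 3 W W' E hcong

end Twin

end Summit.BirchSwinnertonDyer.BirchSwinnertonDyer.Theorems.UniversalToricDescentTowerTorsion

end
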